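/-
Summits.PneNP.TribunalEnv — GENERATED by harness/kit/tribunal_env.py (2026-08-20T23:44:51Z); import-only aggregate for the kernel tribunal (D-0034).
NEVER import this from a Theorems/Theses/Cruxes file (gate4 2026-08-17). Regenerate + `ledger build Summits.PneNP.TribunalEnv` together (≤ hourly).
Contents: 2 Statement modules, strong-hypothesis library present, 71 Theses, 122 criterion/converse theorem modules (of 122 candidates; cap), 0 unbuilt skipped, 0 excluded after check.
Full lists: run/shared/lean/tribunal/env/PneNP.json
-/
import Summits.PneNP.Statement
import Summits.PneNP.PneNP.Statement
import Literature.StrongHypotheses.PneNP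
import Summits.PneNP.StrongHypotheses
import Summits.PneNP.PneNP.Theses.AeaCutRectangles
import Summits.PneNP.PneNP.Theses.AperiodicTorus
import Summits.PneNP.PneNP.Theses.ArnoldMorseDeficit
import Summits.PneNP.PneNP.Theses.Autoreducibility
import Summits.PneNP.PneNP.Theses.BISOrderDimension
import Summits.PneNP.PneNP.Theses.BavardGap
import Summits.PneNP.PneNP.Theses.BorrowedMemory
import Summits.PneNP.PneNP.Theses.BruckRyserSos
import Summits.PneNP.PneNP.Theses.CanonicalForms
import Summits.PneNP.PneNP.Theses.ChoicelessCapture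
import Summits.PneNP.PneNP.Theses.Circuit
import Summits.PneNP.PneNP.Theses.Circuit2
import Summits.PneNP.PneNP.Theses.CnfIdealGenLength
import Summits.PneNP.PneNP.Theses.CodingVolumeShifts
import Summits.PneNP.PneNP.Theses.ConvexRankGates
import Summits.PneNP.PneNP.Theses.DelsarteLasserre
import Summits.PneNP.PneNP.Theses.DescentTower
import Summits.PneNP.PneNP.Theses.Descriptive
import Summits.PneNP.PneNP.Theses.DirichletPigeons
import Summits.PneNP.PneNP.Theses.EcdlpDefinability
import Summits.PneNP.PneNP.Theses.EfNotPOptimal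
import Summits.PneNP.PneNP.Theses.ExpanderLinearGenerators
import Summits.PneNP.PneNP.Theses.FeasibleWitnessing
import Summits.PneNP.PneNP.Theses.Feige
import Summits.PneNP.PneNP.Theses.FineGrained
import Summits.PneNP.PneNP.Theses.ForcedSplits
import Summits.PneNP.PneNP.Theses.FreeHardnessEF
import Summits.PneNP.PneNP.Theses.FregeLinesACUniverse
import Summits.PneNP.PneNP.Theses.HeisenbergSparsestCut
import Summits.PneNP.PneNP.Theses.KarlinRubin
import Summits.PneNP.PneNP.Theses.Kloosterman
import Summits.PneNP.PneNP.Theses.KrwChromaticSteering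
import Summits.PneNP.PneNP.Theses.Ktlang
import Summits.PneNP.PneNP.Theses.Lattice
import Summits.PneNP.PneNP.Theses.LatticeMagic
import Summits.PneNP.PneNP.Theses.Learning
import Summits.PneNP.PneNP.Theses.LightLogic
import Summits.PneNP.PneNP.Theses.LyapunovRefutations
import Summits.PneNP.PneNP.Theses.MatroidTseitin
import Summits.PneNP.PneNP.Theses.MetaCplx
import Summits.PneNP.PneNP.Theses.Mobius
import Summits.PneNP.PneNP.Theses.MonochromaticLines
import Summits.PneNP.PneNP.Theses.NegLimited
import Summits.PneNP.PneNP.Theses.NoTardosTropics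
import Summits.PneNP.PneNP.Theses.NonThreeColCutRectangles
import Summits.PneNP.PneNP.Theses.NtimeComplementLadder
import Summits.PneNP.PneNP.Theses.NtimeNotUnambiguousLadder
import Summits.PneNP.PneNP.Theses.ORIncompressibility
import Summits.PneNP.PneNP.Theses.OneSlice
import Summits.PneNP.PneNP.Theses.OverlapGapAlgebra
import Summits.PneNP.PneNP.Theses.PermanentDescent
import Summits.PneNP.PneNP.Theses.PhaseTwins
import Summits.PneNP.PneNP.Theses.PlantedClique
import Summits.PneNP.PneNP.Theses.PositionalGames
import Summits.PneNP.PneNP.Theses.PrimalityPlaces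
import Summits.PneNP.PneNP.Theses.ProofCplx
import Summits.PneNP.PneNP.Theses.ProofSpaceOGP
import Summits.PneNP.PneNP.Theses.Proofcplx
import Summits.PneNP.PneNP.Theses.RamseyAliens
import Summits.PneNP.PneNP.Theses.RamseyThreshold
import Summits.PneNP.PneNP.Theses.RamseyUncertifiable
import Summits.PneNP.PneNP.Theses.ReslinMediumCover
import Summits.PneNP.PneNP.Theses.ReslinSizeFromWidth
import Summits.PneNP.PneNP.Theses.RevResPhpExactCovers
import Summits.PneNP.PneNP.Theses.StraightLineSign
import Summits.PneNP.PneNP.Theses.SymmetryBudget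
import Summits.PneNP.PneNP.Theses.SzkEntropy
import Summits.PneNP.PneNP.Theses.TwoTones
import Summits.PneNP.PneNP.Theses.UncheckableSAT
import Summits.PneNP.PneNP.Theses.UniformStream
import Summits.PneNP.PneNP.Theses.WitnessForging
import Summits.PneNP.PneNP.Theorems.SoloBlindEquivalentForms2
import Summits.PneNP.PneNP.Cruxes.NoORCompression.StrategyCensus
import Summits.PneNP.PneNP.Theorems.PhaseTwinsNoFBPPApproxAboveUniquenessConjectureNode
import Summits.PneNP.PneNP.Cruxes.HamCompiles.Disproof
import Summits.PneNP.PneNP.Cruxes.Target.DecompositionAuditDelsarteLasserre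
import Summits.PneNP.PneNP.Theorems.SoloBlindCollapseWorld
import Summits.PneNP.PneNP.Theorems.SoloBlindCorridorMap
import Summits.PneNP.PneNP.Theorems.SoloBlindCountingFloor
import Summits.PneNP.PneNP.Theorems.SoloBlindTheoremESharpCor
import Summits.PneNP.PneNP.Theorems.SoloBlindCorridorMap2
import Summits.PneNP.PneNP.Cruxes.MetacplxThesis.CensusProbes
import Summits.PneNP.PneNP.Cruxes.NoFBPPApproxAboveUniqueness.DecompositionAudit
import Summits.PneNP.PneNP.Cruxes.RamseyNotNP.ReExamCertificate
import Summits.PneNP.PneNP.Theorems.SoloBlindFloor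
import Summits.PneNP.PneNP.Theorems.SymmetryBudgetWindowHamOfHardPRG
import Summits.PneNP.PneNP.Cruxes.NoPOptimalTaut.DecompositionAudit
import Summits.PneNP.PneNP.Theorems.SoloInformedLinearLadderIff
import Summits.PneNP.PneNP.Cruxes.CircuitThesis.StrategyCensus
import Summits.PneNP.PneNP.Cruxes.PeaThreeNotInP.StrategyCensusObstructions
import Summits.PneNP.PneNP.Theorems.SoloInformedIsomorphism
import Summits.PneNP.PneNP.Theorems.SymmetryBudgetWindowHamOfNonuniformOWF
import Summits.PneNP.PneNP.Cruxes.EcdlpNotInP.StrategyCensus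
import Summits.PneNP.PneNP.Cruxes.RamseyNotNP.WallBreakerCertificate
import Summits.PneNP.PneNP.Theorems.SoloBlindEquivalentForms
import Summits.PneNP.PneNP.Theorems.SoloInformedApproximationRate
import Summits.PneNP.PneNP.Cruxes.WindowHam.StrategyCensusD1
import Summits.PneNP.PneNP.Theorems.KarlinRubinMonotoneSufficesDecompCensus
import Summits.PneNP.PneNP.Cruxes.HardnessTransfer.Disproof
import Summits.PneNP.PneNP.Theorems.SoloBlindCorridorMap3
import Summits.PneNP.PneNP.Theorems.SoloBlindDiagonalEntry
import Summits.PneNP.PneNP.Theorems.SoloInformedRefuters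
import Summits.PneNP.PneNP.Cruxes.RamseyNotNP.Disproof
import Summits.PneNP.PneNP.Theorems.SoloBlindAnchor
import Summits.PneNP.PneNP.Cruxes.NoFBPPApproxAboveUniqueness.StrategyCensus
import Summits.PneNP.PneNP.Theorems.SoloInformedQuantifierShape
import Summits.PneNP.PneNP.Cruxes.EcdlpNotInP.ProbesB
import Summits.PneNP.PneNP.Cruxes.PlantedRootHardness.StrategyCensus
import Summits.PneNP.PneNP.Cruxes.SliceTarget.StrategyCensus
import Summits.PneNP.PneNP.Theorems.SoloBlindSparseHierarchy
import Summits.PneNP.PneNP.Theorems.SoloBlindStreamingMagnification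
import Summits.PneNP.PneNP.Theorems.SoloInformedSparse
import Summits.PneNP.PneNP.Theorems.UniformStreamUniformStreamLBSummitHard
import Summits.PneNP.PneNP.Cruxes.IdealsNoFPRAS.DecompositionAudit
import Summits.PneNP.PneNP.Theorems.ExpanderLinearGeneratorsAssembly
import Summits.PneNP.PneNP.Theorems.SoloBlindSparseHierarchyStream
import Summits.PneNP.PneNP.Theorems.SoloBlindStreamingCompleteness
import Summits.PneNP.PneNP.Cruxes.WindowBarrier.Disproof
import Summits.PneNP.PneNP.Theorems.KarlinRubinMonotoneSufficesDecompCensusSlice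
import Summits.PneNP.PneNP.Theorems.SoloBlindFactFreeMagnification
import Summits.PneNP.PneNP.Theorems.SoloInformedIOShape
import Summits.PneNP.PneNP.Theorems.SoloInformedLinearLadder
import Summits.PneNP.PneNP.Theorems.SoloInformedResBound
import Summits.PneNP.PneNP.Theorems.Target.Negative.StHypProvesSummit
import Summits.PneNP.PneNP.Cruxes.NoORCompression.Probes
import Summits.PneNP.PneNP.Cruxes.PolyTimeIsCatalytic.StrategyCensus
import Summits.PneNP.PneNP.Theorems.ExpanderLinearGeneratorsNoPolyBoundedProofSystemLadder
import Summits.PneNP.PneNP.Theorems.SoloBlindStreamingCalibration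
import Summits.PneNP.PneNP.Theorems.SoloBlindTheoremESharp
import Summits.PneNP.PneNP.Theorems.SoloBlindUniformMagnification
import Summits.PneNP.PneNP.Theorems.NPNotSubsetBPP
import Summits.PneNP.PneNP.Theorems.RamseyNotNP.Negative.ComplementSymmetry
import Summits.PneNP.PneNP.Theorems.RamseyNotNP.Negative.Sandwich
import Summits.PneNP.PneNP.Theorems.SoloInformedLinearLadderWlin
import Summits.PneNP.PneNP.Theorems.SoloInformedResAutomatable
import Summits.PneNP.PneNP.Theorems.SoloInformedResBoundNP
import Summits.PneNP.PneNP.Theorems.SoloInformedResBoundUncond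
import Summits.PneNP.PneNP.Theorems.SoloInformedSlices
import Summits.PneNP.PneNP.Theorems.SymmetryBudgetRigidBenchmarkNPEquivalence
import Summits.PneNP.PneNP.Theorems.SymmetryBudgetRigidBenchmarkSummit
import Summits.PneNP.PneNP.Theorems.SymmetryBudgetWindowHamIffNPNotSubsetPPoly
import Summits.PneNP.PneNP.Cruxes.CollapseMakesPermanentEasy.Disproof
import Summits.PneNP.PneNP.Cruxes.EcdlpNotInP.ProbesA
import Summits.PneNP.PneNP.Cruxes.SearchHardWindow.StrategyCensus3
import Summits.PneNP.PneNP.Theorems.CanonicalFormsCookBridge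
import Summits.PneNP.PneNP.Theorems.ConvexRankGatesCliqueBridgeTerm
import Summits.PneNP.PneNP.Theorems.ConvexRankGatesConvexGateBlindSparseBarrierHolds
import Summits.PneNP.PneNP.Theorems.HamCompiles.Negative.Irrefutable
import Summits.PneNP.PneNP.Theorems.KarlinRubinCliqueCircuitsOfNotPneNP
import Summits.PneNP.PneNP.Theorems.OWFExist
import Summits.PneNP.PneNP.Theorems.OverlapGapAlgebraSearchHardWindowFromTransfer
import Summits.PneNP.PneNP.Theorems.PhaseTwinsNoFBPPApproxAboveUniquenessConjectureWeb
import Summits.PneNP.PneNP.Theorems.SoloBlindTimeConstructible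
import Summits.PneNP.PneNP.Theorems.SoloInformedInstanceHard
import Summits.PneNP.PneNP.Theorems.SoloInformedLevin
import Summits.PneNP.PneNP.Theorems.SoloInformedLogAdvice
import Summits.PneNP.PneNP.Theorems.SoloInformedWitnessKt
import Summits.PneNP.PneNP.Theorems.SymmetryBudgetWindowHamConjectureWeb
import Summits.PneNP.PneNP.Theorems.SzkEntropyPeaThreeMemBPP
import Summits.PneNP.PneNP.Theorems.UniformStreamUniformMagnification
import Summits.PneNP.PneNP.Cruxes.CollapseMakesPermanentEasy.StrategistR1
import Summits.PneNP.PneNP.Cruxes.Target.StrategyCensus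
import Summits.PneNP.PneNP.Theorems.ConvexRankGatesConvexGateBlindSparseBarrier
import Summits.PneNP.PneNP.Theorems.HamCompiles.Negative.BudgetScale
import Summits.PneNP.PneNP.Theorems.LatticeAssembly
import Summits.PneNP.PneNP.Theorems.LatticeMagicTargetIffNPneCoNP
import Summits.PneNP.PneNP.Theorems.LatticeMagicTargetSqueezeStrength
import Summits.PneNP.PneNP.Theorems.OneSliceAssembly
import Summits.PneNP.PneNP.Theorems.OverlapGapAlgebraSearchHardWindowFromCruxes
import Summits.PneNP.PneNP.Theorems.SoloBlindStreamingFooling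
import Summits.PneNP.PneNP.Theorems.SoloInformedOneWay
import Summits.PneNP.PneNP.Theorems.SoloInformedSelective
import Summits.PneNP.PneNP.Theorems.SoloInformedStreaming
import Summits.PneNP.PneNP.Theorems.SymmetryBudgetWindowHamCruxLinks
import Summits.PneNP.PneNP.Cruxes.PeaWorstToAvg.SketchIdeator2
import Summits.PneNP.PneNP.Cruxes.PosSLPInPH.RedirectPosition
import Summits.PneNP.PneNP.Cruxes.SliceTarget.Sketch_ideator3_r1
import Summits.PneNP.PneNP.Cruxes.SolvableImpliesStableSection.Disproof
import Summits.PneNP.PneNP.Cruxes.SolvableImpliesStableSection.SketchR2Ideator4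
import Summits.PneNP.PneNP.Theorems.CollapseMakesPermanentEasy.Negative.Irrefutable
import Summits.PneNP.PneNP.Theorems.ExpanderLinearGeneratorsAssemblyRev6
import Summits.PneNP.PneNP.Theorems.ExpanderLinearGeneratorsTautBridgeTerm
import Summits.PneNP.PneNP.Theorems.KarlinRubinMonotoneSufficesDecompCensusSplits
import Summits.PneNP.PneNP.Theorems.LatticeMagicTargetIffProofcplxThesis
import Summits.PneNP.PneNP.Theorems.LatticeMagicTargetSqueezeAssembly
import Summits.PneNP.PneNP.Theorems.LearningAssembly
import Summits.PneNP.PneNP.Theorems.OverlapGapAlgebraSearchHardWindowCore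
import Summits.PneNP.PneNP.Theorems.OverlapGapAlgebraSearchHardWindowFromMacroTransfer
import Summits.PneNP.PneNP.Theorems.PhaseTwinsPseudorandomTwinsAbovePrgImageTwins
import Summits.PneNP.PneNP.Theorems.SoloBlindStreamingFoolingLinear
import Summits.PneNP.PneNP.Theorems.SoloBlindStreamingTimeOnly
import Summits.PneNP.PneNP.Theorems.SzkEntropyPeaThreeNotInPCoreStubReduction
import Summits.PneNP.PneNP.Theorems.UniformStreamUniformStreamLBOfHardPRG
import HarnessLib.Audit.TribunalTags
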